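import Summits.PneNP.PneNP.Theorems.ChebyshevTracialDesignTightColumnSums
import Literature.Combinatorics.AssociationSchemes.JohnsonSpectrum
import HarnessLib

/-!
# Cell pnp-psdrank, route `ChebyshevTracialDesign`: the odd ladder eigenvalues of the tight Gram kernel vanish

Harmonic backbone, brick 5c — the first eigenvalue statement of the σ₂ brick in lit's `JohnsonSpectrum` vocabulary
(`kernelEigen`, `sum_sq_gram_ladder`, the dipole test vectors `dipoleVec`; p432537/p432863/p437261/…). Let
`A(U,M) = 1[#{x ∈ U : partner_M x ∉ U} = 1]` be the TIGHT INCIDENCE between `t`-subsets of `Fin n` (`t` odd) and the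
perfect matchings `M : PMatch n` of `K_n` (`= 1[cc(U,M) = 1]`, `cc_eq_card_filter_partner`), and let `κ` be its Gram class
function on the `t`-sets (`Σ_M A(U,M)A(U',M) = κ(|U ∩ U'|)`, a class function by `card_jointTight_eq`, p430440). Then for
every ODD `j ≤ t` (`2t ≤ n`): `kernelEigen n t j κ = 0` (`kernelEigen_tight_eq_zero_of_odd`) — the tight relation has NO
odd Johnson modes. Proof: `sum_sq_gram_ladder` evaluates `‖Aᵀ f‖²` on the layer-`j` test vector `f = (Wᵀ)^{t−j} χ`
(`χ` = the `j`-dipole product, nonzero: `sum_sq_ladder_dipoleVec`) as `kernelEigen · ‖f‖²`, while every column sum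
`Σ_{U tight for M} f(U)` vanishes by `tight_column_sum`/`tightSum_zeta_eq_zero_of_odd` (p439215/p439519: the pairing
recurrence on the matching side). Also the EVEN-degree identity `kernelEigen_tight_even_mul`:
`kernelEigen n t (2κ) κ · (Π ladder) · 2^{2κ} = ((t−2κ)!·(n−t+1−2κ)·C(n/2−2κ,(t−1)/2−κ))² · Σ_M Π_χ(M)²`, reducing
(★★) of MEMO-7 to the single matching-side norm `Σ_M Π_χ(M)²`. [cite: Rothvoss2017, §2 (PDF p. 6)]
[cite: GodsilMeagher2015, §15.2 (perfect matching scheme)] WHAT THIS IS NOT: the even eigenvalues are not yet in closed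
form (one count remains), so the σ₂ bound `μν ≤ (1−μ)λ₂/λ₀` is not yet assembled; nothing on psd rank. Supports crux
stmt-PneNP-19878.
-/

set_option linter.dupNamespace false -- `Summit.PneNP.PneNP.…`: summit = sub-problem (D-0017)

noncomputable section

namespace Summit.PneNP.PneNP.Theorems.ChebyshevTracialDesignTightOddLayers

open Finset Literature.Combinatorics.AssociationSchemes Literature.Combinatorics.AssociationSchemes.JohnsonHarmonics
open Literature.Combinatorics.AssociationSchemes.JohnsonSpectrum
open Literature.Barriers.PneNP
open Summit.PneNP.PneNP.Theorems.ChebyshevTracialDesignTightLayerSums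
open Summit.PneNP.PneNP.Theorems.ChebyshevTracialDesignTightColumnSums

variable {n : ℕ}

/-- The standard `j` disjoint dipoles `(2i, 2i+1)`, `i < j`, inside `Fin n` (`2j ≤ n`): injective with disjoint ranges. -/
theorem standardDipoles_props {j : ℕ} (hj : 2 * j ≤ n) :
    Function.Injective (fun i : Fin j => (⟨2 * i.1, by omega⟩ : Fin n)) ∧
      Function.Injective (fun i : Fin j => (⟨2 * i.1 + 1, by omega⟩ : Fin n)) ∧
        ∀ i i' : Fin j, (⟨2 * i.1, by omega⟩ : Fin n) ≠ ⟨2 * i'.1 + 1, by omega⟩ := by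
  refine ⟨fun i i' h => ?_, fun i i' h => ?_, fun i i' h => ?_⟩
  · apply Fin.ext; have := Fin.mk.inj_iff.1 h; omega
  · apply Fin.ext; have := Fin.mk.inj_iff.1 h; omega
  · have := Fin.mk.inj_iff.1 h; omega

/-- Column sums of a ladder test function against the tight incidence are factorial multiples of the tight
`zeta` sums. -/
theorem column_sum_ladder_eq {t j : ℕ} (hjt : j ≤ t) {p : Finset (Fin n) → ℝ} (hp : IsHomog j p) (M : PMatch n) :
    ∑ U ∈ univ.powersetCard t, (up^[t - j] p) U *
        (if (U.filter fun x => M.2.partner x ∉ U).card = 1 then (1 : ℝ) else 0) =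
      ((t - j).factorial : ℝ) * ∑ U ∈ (powersetCard t (univ : Finset (Fin n))).filter
        (fun U => (U.filter fun x => M.2.partner x ∉ U).card = 1), zeta p U := by
  rw [sum_filter, mul_sum]
  refine sum_congr rfl fun U hU => ?_
  rw [ladder_apply_eq_factorial_mul_zeta hjt hp (mem_powersetCard.1 hU).2]
  split_ifs <;> ring

/-- **Odd ladder eigenvalues of the tight Gram kernel vanish.** For `t` odd with `2t ≤ n`, `j ≤ t` odd, and `κ` the
Gram class function of the tight incidence on the `t`-sets: `kernelEigen n t j κ = 0`. -/
theorem kernelEigen_tight_eq_zero_of_odd {t j : ℕ} (htodd : Odd t) (ht : 2 * t ≤ n) (hjt : j ≤ t) (hj : Odd j)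
    (κ : ℕ → ℝ)
    (hA : ∀ U ∈ univ.powersetCard t, ∀ U' ∈ univ.powersetCard t,
      ∑ M : PMatch n, (if (U.filter fun x => M.2.partner x ∉ U).card = 1 then (1 : ℝ) else 0) *
        (if (U'.filter fun x => M.2.partner x ∉ U').card = 1 then (1 : ℝ) else 0) = κ (U ∩ U').card) :
    kernelEigen n t j κ = 0 := by
  obtain ⟨ha, hb, hab⟩ := standardDipoles_props (n := n) (j := j) (by omega)
  set a : Fin j → Fin n := fun i => ⟨2 * i.1, by omega⟩
  set b : Fin j → Fin n := fun i => ⟨2 * i.1 + 1, by omega⟩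
  have hp := isHarmonic_dipoleVec ha hb hab
  have hgram := sum_sq_gram_ladder hjt
    (fun U (M : PMatch n) => if (U.filter fun x => M.2.partner x ∉ U).card = 1 then (1 : ℝ) else 0) κ hA hp
  -- every column sum vanishes (odd layers are invisible to the tight relation)
  have hcol : ∀ M : PMatch n, ∑ U ∈ univ.powersetCard t, (up^[t - j] (dipoleVec j a b)) U *
      (if (U.filter fun x => M.2.partner x ∉ U).card = 1 then (1 : ℝ) else 0) = 0 := by
    intro M
    rw [column_sum_ladder_eq hjt hp.1 M]
    obtain ⟨c, rfl⟩ := htodd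
    rw [tightSum_zeta_eq_zero_of_odd (partner_invol M).1 (partner_invol M).2 hj hp c, mul_zero]
  simp only [hcol] at hgram
  simp only [ne_eq, OfNat.ofNat_ne_zero, not_false_eq_true, zero_pow, sum_const_zero] at hgram
  -- `‖f‖² > 0`
  have hnorm : 0 < ip (up^[t - j] (dipoleVec j a b)) (up^[t - j] (dipoleVec j a b)) := by
    rw [ip_iterate_up_of_isHarmonic hp, ip_dipoleVec_self j a b ha hb hab]
    exact mul_pos (ladderProd_range_pos hjt ht) (by positivity)
  rcases mul_eq_zero.1 hgram.symm with h | h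
  · exact h
  · exact absurd h hnorm.ne'

/-- **Even-degree identity.** For `t = 2c+1` with `2t ≤ n`, `2κ ≤ t` with `4κ ≤ n`... precisely `κ' ≤ c`, and `κ` the Gram
class function of the tight incidence: with `χ` the `2κ'`-dipole product,
`kernelEigen n t (2κ') κ · ⟪(Wᵀ)^{t−2κ'}χ, (Wᵀ)^{t−2κ'}χ⟫ = ((t−2κ')!·(n−2c−2κ')·C(n/2−2κ', c−κ'))² · Σ_M Π_χ(M)²`,
where `Π_χ(M) = Σ_{T : #{x ∈ T : partner x ∈ T} = 2κ'} χ_T`. -/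
theorem kernelEigen_tight_even_mul {c κ' : ℕ} (ht : 2 * (2 * c + 1) ≤ n) (hκc : κ' ≤ c) (hκn : 4 * κ' ≤ n)
    (κ : ℕ → ℝ)
    (hA : ∀ U ∈ univ.powersetCard (2 * c + 1), ∀ U' ∈ univ.powersetCard (2 * c + 1),
      ∑ M : PMatch n, (if (U.filter fun x => M.2.partner x ∉ U).card = 1 then (1 : ℝ) else 0) *
        (if (U'.filter fun x => M.2.partner x ∉ U').card = 1 then (1 : ℝ) else 0) = κ (U ∩ U').card) :
    kernelEigen n (2 * c + 1) (2 * κ') κ *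
        ip (up^[2 * c + 1 - 2 * κ'] (dipoleVec (2 * κ') (fun i : Fin (2 * κ') => (⟨2 * i.1, by omega⟩ : Fin n))
              (fun i => ⟨2 * i.1 + 1, by omega⟩)))
           (up^[2 * c + 1 - 2 * κ'] (dipoleVec (2 * κ') (fun i : Fin (2 * κ') => (⟨2 * i.1, by omega⟩ : Fin n))
              (fun i => ⟨2 * i.1 + 1, by omega⟩))) =
      ∑ M : PMatch n,
        ((((2 * c + 1 - 2 * κ').factorial : ℝ) *
          (((n : ℝ) - (2 * c : ℕ) - (2 * κ' : ℕ)) * ((((n / 2 - 2 * κ').choose (c - κ') : ℕ) : ℝ) *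
            ∑ T ∈ univ.filter (fun T : Finset (Fin n) => (T.filter fun x => M.2.partner x ∈ T).card = 2 * κ'),
              dipoleVec (2 * κ') (fun i : Fin (2 * κ') => (⟨2 * i.1, by omega⟩ : Fin n))
                (fun i => ⟨2 * i.1 + 1, by omega⟩) T))) ^ 2) := by
  obtain ⟨ha, hb, hab⟩ := standardDipoles_props (n := n) (j := 2 * κ') (by omega)
  have hp := isHarmonic_dipoleVec ha hb hab
  have hjt : 2 * κ' ≤ 2 * c + 1 := by omega
  have hgram := sum_sq_gram_ladder hjt
    (fun U (M : PMatch n) => if (U.filter fun x => M.2.partner x ∉ U).card = 1 then (1 : ℝ) else 0) κ hA hp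
  rw [← hgram]
  refine sum_congr rfl fun M _ => ?_
  rw [column_sum_ladder_eq hjt hp.1 M, ← sum_tight_oddSet_eq M ⟨c, rfl⟩,
    tight_column_sum_eq_of_even M hκn hκc hp]

end Summit.PneNP.PneNP.Theorems.ChebyshevTracialDesignTightOddLayers
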